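import Summits.QuantumAdvantage.QuantumAdvantage.Theses.SosSandwich
import Literature.Computability.QuantumComplexity.PolynomialMethod

/-!
# Route `SosSandwich`: support item `QueryAcceptPseudoBounded` (stmt-QuantumAdvantage-15242)

`Q_T ⊆ K_T`: the acceptance probability of a `T`-query quantum algorithm (tree `QQueryAlg`, XOR-oracle
model) is pseudo-bounded of order `T`. By Beals et al. Lemma 4.1 (tree: `hasDegreeLE_finalState`) every
final amplitude is, on the cube, `P_s(x) + i Q_s(x)` with real polynomials `P_s, Q_s` of total degree
`≤ T`; so `acceptProb = Σ_{s ∈ accept} P_s² + Q_s²`, and by unitarity (`sum_norm_sq_finalState`: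
`Σ_s ‖amplitude_s‖² = 1`) `1 - acceptProb = Σ_{s ∉ accept} P_s² + Q_s²` — two SOS certificates of degree
`≤ T`, re-indexed by `Fin m` through `Fintype.equivFin`.
-/

set_option linter.dupNamespace false -- D-0017: single-problem summit ⇒ `QuantumAdvantage.QuantumAdvantage` by design

namespace Summit.QuantumAdvantage.QuantumAdvantage.Theorems.SosSandwich

open MvPolynomial Finset Literature.Computability.Cryptography Literature.Computability.QuantumComplexity
  Literature.Computability.Complexity

/-- **`SosSandwich.QueryAcceptPseudoBounded`** (stmt-QuantumAdvantage-15242): `Q_T ⊆ K_T` — for every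
`T`-query quantum algorithm there are real polynomials `q_j, r_j` of total degree `≤ T` with
`acceptProb = Σ q_j²` and `1 - acceptProb = Σ r_j²` on the cube (real and imaginary parts of the accepted,
resp. rejected, amplitude polynomials; Beals et al. Lemma 4.1 plus unitarity).
[cite: BealsEtAl2001, Lemma 4.1 and Lemma 4.2] [cite: KaniewskiLeeDewolf2015, Thm. 12] -/
theorem QueryAcceptPseudoBounded_proof :
    Summit.QuantumAdvantage.QuantumAdvantage.Theses.SosSandwich.QueryAcceptPseudoBounded := by
  unfold Summit.QuantumAdvantage.QuantumAdvantage.Theses.SosSandwich.QueryAcceptPseudoBounded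
  intro N A ev
  classical
  choose P Q hP hQ h using fun s => hasDegreeLE_finalState A s
  beta_reduce at h
  have hev0 : ∀ x : Fin N → Bool, ev 0 x = 0 := fun x => map_zero (MvPolynomial.eval _)
  -- index: (basis state, real/imaginary part)
  set ι := (Fin N × Bool × A.W) × Bool with hι
  set e : ι ≃ Fin (Fintype.card ι) := Fintype.equivFin ι with he
  set qf : ι → MvPolynomial (Fin N) ℝ :=
    fun sb => if sb.1 ∈ A.accept then (if sb.2 then P sb.1 else Q sb.1) else 0 with hqf
  set rf : ι → MvPolynomial (Fin N) ℝ :=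
    fun sb => if sb.1 ∈ A.accept then 0 else (if sb.2 then P sb.1 else Q sb.1) with hrf
  -- the value identity per basis state
  have hnorm : ∀ (x : Fin N → Bool) (s : Fin N × Bool × A.W),
      ‖A.finalState x s‖ ^ 2 = ev (P s) x ^ 2 + ev (Q s) x ^ 2 := by
    intro x s
    have e1 : ev (P s) x = MvPolynomial.eval (Multilinear.boolPt (R := ℝ) x) (P s) := rfl
    have e2 : ev (Q s) x = MvPolynomial.eval (Multilinear.boolPt (R := ℝ) x) (Q s) := rfl
    rw [e1, e2, h s x, Complex.sq_norm, Complex.normSq_apply]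
    simp
    ring
  refine ⟨Fintype.card ι, fun j => qf (e.symm j), fun j => rf (e.symm j), fun j => ⟨?_, ?_⟩,
    fun x => ⟨?_, ?_⟩⟩
  · simp only [hqf]
    split_ifs
    · exact hP _
    · exact hQ _
    · simp
  · simp only [hrf]
    split_ifs
    · simp
    · exact hP _
    · exact hQ _
  · rw [Equiv.sum_comp e.symm (fun sb => ev (qf sb) x ^ 2), Fintype.sum_prod_type]
    simp only [Fintype.sum_bool]
    unfold QQueryAlg.acceptProb
    rw [Finset.sum_filter]
    refine Finset.sum_congr rfl fun s _ => ?_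
    split_ifs with hs
    · simp only [hqf, hs, if_true]
      simp only [Bool.false_eq_true, if_false]
      rw [hnorm x s]
    · simp [hqf, hs, hev0]
  · rw [Equiv.sum_comp e.symm (fun sb => ev (rf sb) x ^ 2), Fintype.sum_prod_type]
    simp only [Fintype.sum_bool]
    unfold QQueryAlg.acceptProb
    rw [Finset.sum_filter, ← sum_norm_sq_finalState A x, ← Finset.sum_sub_distrib]
    refine Finset.sum_congr rfl fun s _ => ?_
    split_ifs with hs
    · simp [hrf, hs, hev0]
    · simp only [hrf, hs, if_false, if_true]
      simp only [Bool.false_eq_true, if_false]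
      rw [hnorm x s]
      ring

end Summit.QuantumAdvantage.QuantumAdvantage.Theorems.SosSandwich
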